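import Summits.BirchSwinnertonDyer.BirchSwinnertonDyer.Theorems.SchneiderFreeAdditiveX3BranchIMCRebaseCovolume
import Summits.BirchSwinnertonDyer.BirchSwinnertonDyer.Theorems.SchneiderFreeAdditiveX3PotMultBranchIMCBarrier
import HarnessLib

/-!
# Route `SchneiderFreeAdditiveX3` (K1 door), crux `PotMultBranchIMC` (stmt-BirchSwinnertonDyer-19176):
# link (L3) of the rebased road on the (M) cell — the TWIST COVOLUME relation WITHOUT `v_p Δ_min(V) < 6`

Cell `bsd-schneider-ideate`, seat `bsd-schneider-door-c4` (prover, generation 8). HONEST FRAMING: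
door-c3 g5 discharged link (L3) of the rebased value road — `p · covol(Λ_W) = u(C)² · covol(Λ_V)`
with `u(C) ≠ 0`, `v_p(u(C)) = 0` for `W = C • (V ⊗ χ_{p*})` — under the hypothesis
`v_p Δ_min(V) < 6` (`covolume_link_of_twist_pStar`), which is automatic on the (G-ord, `e = 2`)
cell (`V` good at `p`) but on the potentially MULTIPLICATIVE cell (M) the partner `V` is of type
`I_n` at `p` with `n = v_p Δ_min(V)` unbounded; door-c2 g8's (M) frame theorem
`potMult_additiveIMCLowerBDPOnTreeLeAt_of_valueAt_twisted_of_thm15_of_genusDatum` therefore CARRIES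
`hVΔ : v_p Δ_min(V) < 6` (FINDING-door-c2-g8 §2, want W3: "the c₄ form of the twist-minimality
lemma"). That c₄ form is ALREADY a theorem of the tree — the additive cell's
`Additive.padicValRat_u_eq_zero_of_twist_pm_p` (`Rank1Residual/Additive/RamifiedTwistMinimality.lean`:
for `V` globally minimal, GOOD OR MULTIPLICATIVE at the odd prime `p`, and `C • V^{(±p)} = W`
globally minimal, `v_p u(C) = 0`, because `V^{(±p)}` is `p`-minimal: `v_p(c₄(V^{(±p)})) = 2 < 4` in
the multiplicative case, Silverman *AEC* VII.1 Remark 1.1) — so (L3) holds on the WHOLE (M) cell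
with no bound on `n`. This file records it in the shape of `covolume_link_of_twist_pStar`
(`covolume_link_of_twist_pStar_of_semistable`) and packages it for a `ClassX2` partner
(`covolume_link_of_classX2_partner`) and for the (M) cell (`exists_partner_covolume_link_of_subM`).
Nothing is asserted about BSD; the crux stays OPEN; `--supports` material for item 19176.

References: V. Pal, Proc. AMS 140 (2012) Lemma 3.1, Prop. 2.5; Silverman *AEC* VII.1 Remark 1.1,
Prop. VII.1.3 (b), VII.5 Prop. 5.1.
-/

noncomputable section

open scoped Classical

open WeierstrassCurve NumberField
  Literature.NumberTheory.EllipticCurves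
  Literature.NumberTheory.EllipticCurves.ModularForms
  Literature.NumberTheory.EllipticCurves.Rank1Residual
  Summit.BirchSwinnertonDyer.Rank1Residual

-- D-0017 layout: summit = sub-problem, so `Summit.BirchSwinnertonDyer.BirchSwinnertonDyer.…` is the
-- mandated namespace (same option as the route's sockets files).
set_option linter.dupNamespace false
set_option autoImplicit false

namespace Summit.BirchSwinnertonDyer.BirchSwinnertonDyer.Theorems.SchneiderFree

/-- **Link (L3) for a `p*`-twist pair with `V` semistable at `p` (no bound on `v_p Δ_min(V)`).**
Let `p` be odd, `V /ℚ` globally minimal elliptic, good OR MULTIPLICATIVE at `p` (`Good V p ∨ Mult V p`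
— on the (M) cell the partner is of type `I_n`, any `n`), `W = C • (V ⊗ χ_{p*})` globally minimal
elliptic, and `Dt`, `Dt′` parametrisation data of `W`, `V` (any levels). Then `u(C) ≠ 0`,
`v_p(u(C)) = 0` (the tree's `Additive.padicValRat_u_eq_zero_of_twist_pm_p`: `V^{(±p)}` is
`p`-minimal — `v_p Δ = 6 < 12` in the good case, `v_p c₄ = 2 < 4` in the multiplicative case — and
two `p`-minimal equations differ by a `p`-unit, Silverman *AEC* VII.1.3 (b)) and
`p · covol(Λ_W) = u(C)² · covol(Λ_V)` (Pal 2012 Lemma 3.1, tree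
`ModularParametrizationData.covolume_eq_of_smul_quadraticTwist_pStar`) — verbatim the hypotheses
`hutw`, `hptw`, `hcov` of `additiveIMCLowerBDPOnTreeLeAt_of_valueAt_twisted[_of_heightFormula]`.
[cite: Pal2012, Lemma 3.1 and Prop. 2.5] [cite: SilvermanAEC2009, VII.1 Remark 1.1 and Prop. VII.1.3 (b)] -/
theorem covolume_link_of_twist_pStar_of_semistable {p : ℕ} [Fact p.Prime] (hp2 : p ≠ 2)
    (V W : WeierstrassCurve ℚ) [V.IsElliptic] [V.IsGloballyMinimal] [W.IsElliptic]
    [W.IsGloballyMinimal] (hV : Good V p ∨ Mult V p) (C : VariableChange ℚ)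
    (hC : C • V.quadraticTwist ((-1 : ℚ) ^ (p / 2) * p) = W) {N M : ℕ} [NeZero N] [NeZero M]
    (Dt : ModularParametrizationData W N) (Dt' : ModularParametrizationData V M) :
    (C.u : ℚ) ≠ 0 ∧ padicValRat p (C.u : ℚ) = 0 ∧
      (p : ℝ) * ZLattice.covolume Dt.L.lattice =
        (((C.u : ℚ) : ℝ)) ^ 2 * ZLattice.covolume Dt'.L.lattice := by
  have hp : p.Prime := Fact.out
  obtain ⟨hcast, hd⟩ := Additive.pStar_intCast p
  have hC' : C • V.quadraticTwist ((((-1 : ℤ) ^ (p / 2) * p : ℤ)) : ℚ) = W := by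
    rw [hcast]; exact hC
  refine ⟨C.u.ne_zero, Additive.padicValRat_u_eq_zero_of_twist_pm_p p hp2 V W hV hd C hC', ?_⟩
  have hp0 : (p : ℝ) ≠ 0 := by exact_mod_cast hp.ne_zero
  rw [ModularParametrizationData.covolume_eq_of_smul_quadraticTwist_pStar C hC' Dt' Dt]
  field_simp

/-- **(L3) for a `ClassX2` partner.** If `V` is a `ClassX2` curve at `p` (`p` odd, `E[p]` reducible,
`V` MULTIPLICATIVE at `p`) with `C • (V ⊗ χ_{p*}) = W`, `V, W` globally minimal, then for all
parametrisation data the covolume link holds with `v_p(u(C)) = 0` — the case of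
`covolume_link_of_twist_pStar_of_semistable` used on the (M) cell, where the partner produced by
`exists_classX2_partner_of_subM` / `exists_partner_roadData_of_subM` is `ClassX2`.
[cite: Pal2012, Lemma 3.1 and Prop. 2.5] -/
theorem covolume_link_of_classX2_partner {p : ℕ} [Fact p.Prime]
    (V W : WeierstrassCurve ℚ) [V.IsElliptic] [V.IsGloballyMinimal] [W.IsElliptic]
    [W.IsGloballyMinimal] (hX2 : ClassX2 V p) (C : VariableChange ℚ)
    (hC : C • V.quadraticTwist ((-1 : ℚ) ^ (p / 2) * p) = W) {N M : ℕ} [NeZero N] [NeZero M]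
    (Dt : ModularParametrizationData W N) (Dt' : ModularParametrizationData V M) :
    (C.u : ℚ) ≠ 0 ∧ padicValRat p (C.u : ℚ) = 0 ∧
      (p : ℝ) * ZLattice.covolume Dt.L.lattice =
        (((C.u : ℚ) : ℝ)) ^ 2 * ZLattice.covolume Dt'.L.lattice :=
  covolume_link_of_twist_pStar_of_semistable hX2.1 V W (Or.inr hX2.2.2) C hC Dt Dt'

/-- **(L3) on the (M) cell, packaged.** For `W` globally minimal, `p` odd, `ClassX3 W p` and
`SubM W p` (potentially multiplicative, reducible `E[p]`) and ANY parametrisation datum `Dt` of `W`: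
there are a globally minimal `ClassX2` partner `V` (multiplicative at `p`) and `C` with
`C • (V ⊗ χ_{p*}) = W` such that for every parametrisation datum `Dt′` of `V` the covolume link
`p · covol(Λ_W) = u(C)² · covol(Λ_V)` holds with `u(C) ≠ 0`, `v_p(u(C)) = 0` — the (M) twin of
door-c3 g5's `exists_partner_covolume_link_of_subGordTwo` (there `p ≥ 5`; here every odd `p`, in
particular `p = 3`). [cite: Pal2012, Lemma 3.1 and Prop. 2.5] -/
theorem exists_partner_covolume_link_of_subM {p : ℕ} [Fact p.Prime] (hp2 : p ≠ 2)
    (W : WeierstrassCurve ℚ) [W.IsElliptic] [W.IsGloballyMinimal] (hX : ClassX3 W p)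
    (hM : Additive.SubM W p) {N : ℕ} [NeZero N] (Dt : ModularParametrizationData W N) :
    ∃ (V : WeierstrassCurve ℚ) (_ : V.IsElliptic) (_ : V.IsGloballyMinimal) (C : VariableChange ℚ),
      C • V.quadraticTwist ((-1 : ℚ) ^ (p / 2) * p) = W ∧ ClassX2 V p ∧
        ∀ {M : ℕ} [NeZero M] (Dt' : ModularParametrizationData V M),
          (C.u : ℚ) ≠ 0 ∧ padicValRat p (C.u : ℚ) = 0 ∧
            (p : ℝ) * ZLattice.covolume Dt.L.lattice =
              (((C.u : ℚ) : ℝ)) ^ 2 * ZLattice.covolume Dt'.L.lattice := by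
  obtain ⟨V, iV, iVm, C, hC, hX2⟩ := exists_classX2_partner_of_subM hp2 W hX hM
  exact ⟨V, iV, iVm, C, hC, hX2, fun Dt' ↦ covolume_link_of_classX2_partner V W hX2 C hC Dt Dt'⟩

end Summit.BirchSwinnertonDyer.BirchSwinnertonDyer.Theorems.SchneiderFree

end
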